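import Summits.QuantumFields.YangMills.Theorems.SwapVirialDeficitBlowUpGnomonicDeficitDefs
import HarnessLib

/-!
# THE TRANSLATED GNOMONIC CHART: the `y`-letter left-translated by a unit quaternion (definitions; sector-001 plumbing of LEAD sfw-p2 g98's
# memo7 plan of record for ⟨stmt-QuantumFields-24197⟩ `SwapVirialDeficit.SwapGluedStiffness`, §E(5) "001 translated chart")

The master gnomonic chart (✓`gnomonicPoint`, ✓`gnoDeficit`) reads the three leader letters `x, y, z` as `±(1, v)`; the letter `y` is the leader `C₂ = Q(y)`
(✓`BlowUp.leaderTuple`).  The flat set of the sector `001` has `C₂` ON THE EQUATOR (`tr C₂ = 0`), i.e. at the gnomonic infinity of the `y`-chart, so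
sector `001` is read in the SAME chart with the `y`-letter LEFT-TRANSLATED by a fixed unit `u` (`u = j`, ✓`BlowUpRing.qJ`, in the cell's convention):
`C₂ = Q(u·y) = Q(u)·Q(±(1, v))` (LEAD g98, board 2026-08-31 19:28Z).  Because the cone law of a letter is invariant under left multiplication by a unit
(✓`ZeroModeSigma.map_mul_left_coneMeasure`), the translated chart has the SAME density `gnoDensity` and the same constant; the chart identities are the next file.
* §1 `mulLeftY u` — the translation `((x, y), z) ↦ ((x, u·y), z)` of the leader letters: `rfl`-lemma, `mulLeftY 1 = id`, composition, measurability, continuity,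
  invariance of `ball3` for `‖u‖ = 1`;
* §2 `trGnomonicPoint u a ε η` — the translated gnomonic point (hub `a`, signs `ε`, coordinates `η`): `rfl`-lemmas against ✓`gnomonicPoint`, `u = 1` recovers it,
  measurability at fixed `(a, ε)` and jointly in `(a, η)`, ★ `blowUpPoint_one_trGnomonicPoint` (its chart point: leaders `leaderTuple a ((x̂, u·ŷ), ẑ)`, followers `Q(±(1,η_f))`);
* §3 `trGnoDeficit u z χ a ε η := chartDeficit L z χ (blowUpPoint 1 (trGnomonicPoint u a ε η))` — the σ-glued deficit of sector `z` read in the translated chart: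
  `u = 1` recovers ✓`gnoDeficit`, `0 ≤ trGnoDeficit`, measurability (fixed `(a, ε)`, joint), and its unfolding to the ring deficit.
CAVEAT (recorded for the width seats): the blow-up dilation ✓`dil3 t` is transverse to the hub axis and does NOT commute with `u * ·`, so the translated deficit
carries no Euler-flow structure (no twin of ✓`gnoDeficit_eulerDilate`); sector `001` is analysed directly in `(a.re, letters)`.
HONEST LABEL: three definitions and bookkeeping; nothing about ⟨24197⟩, ⟨24194⟩ or any rung is proved here; the Yang–Mills mass gap is NOT proved; no summit is
proved by a line.  Seat ym-line-fcl-p3 g47 (cell ym-idea-1, free hands ➎ assembler; item of record ⟨24085⟩ aside, untouched), `--supports stmt-QuantumFields-24197`.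
Three `def`s, theorems otherwise; 0 `sorry`; standard axioms; the series' local `ℍ` instances.  References: [cite: Luscher1983, §2]; [folklore].
-/

set_option autoImplicit false
set_option synthInstance.maxSize 1024

noncomputable section

open MeasureTheory Quaternion Set
open scoped Quaternion BigOperators
open Literature.MathematicalPhysics.QuantumLattice
open Literature.MathematicalPhysics.QuantumFieldTheory hiding SU2
open Summit.QuantumFields.YangMills.Theorems.FemtoTransferGap
open Summit.QuantumFields.YangMills.Theorems.FemtoTransferGap.TT

attribute [local instance] Literature.Analysis.FluidPDE.Tao2016.quatMeasurableSpace
  Literature.Analysis.FluidPDE.Tao2016.quatBorelSpace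
  Literature.MathematicalPhysics.QuantumLattice.secondCountableTopology_su2

namespace Summit.QuantumFields.YangMills.Theorems.SwapVirialDeficit.BlowUpRing

open Summit.QuantumFields.YangMills.Theorems.SwapVirialDeficit.ZeroModeSigma (dil3 ball3 mem_ball3_iff)
open Summit.QuantumFields.YangMills.Theorems.SwapVirialDeficit.BlowUp (leaderTuple dil3_one' dilateIm_one_apply)

variable {L : ℕ} [NeZero L]

/-! ## §1 The left translation of the `y`-letter -/

/-- **The left translation of the `y`-letter** of the leader triple `((x, y), z)` by `u`: `((x, y), z) ↦ ((x, u·y), z)`. [folklore] -/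
def mulLeftY (u : ℍ) (w : (ℍ × ℍ) × ℍ) : (ℍ × ℍ) × ℍ := ((w.1.1, u * w.1.2), w.2)

/-- Unfolding `mulLeftY`. [folklore] -/
theorem mulLeftY_apply (u : ℍ) (w : (ℍ × ℍ) × ℍ) : mulLeftY u w = ((w.1.1, u * w.1.2), w.2) := rfl

/-- The components of `mulLeftY u w`. [folklore] -/
theorem mulLeftY_fst_fst (u : ℍ) (w : (ℍ × ℍ) × ℍ) : (mulLeftY u w).1.1 = w.1.1 := rfl

/-- The translated `y`-letter. [folklore] -/
theorem mulLeftY_fst_snd (u : ℍ) (w : (ℍ × ℍ) × ℍ) : (mulLeftY u w).1.2 = u * w.1.2 := rfl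

/-- The `z`-letter is untouched. [folklore] -/
theorem mulLeftY_snd (u : ℍ) (w : (ℍ × ℍ) × ℍ) : (mulLeftY u w).2 = w.2 := rfl

/-- `mulLeftY 1 = id`. [folklore] -/
@[simp] theorem mulLeftY_one (w : (ℍ × ℍ) × ℍ) : mulLeftY 1 w = w := by
  simp only [mulLeftY, one_mul, Prod.mk.eta]

/-- Composition: `mulLeftY u ∘ mulLeftY v = mulLeftY (u·v)`. [folklore] -/
theorem mulLeftY_mulLeftY (u v : ℍ) (w : (ℍ × ℍ) × ℍ) : mulLeftY u (mulLeftY v w) = mulLeftY (u * v) w := by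
  simp only [mulLeftY, mul_assoc]

/-- `mulLeftY u` commutes with a positive rescaling of the `y`-letter: `u·(t•y) = t•(u·y)`. [folklore] -/
theorem mulLeftY_smul₂ (u : ℍ) (t : ℝ) (x y z : ℍ) : mulLeftY u ((x, t • y), z) = ((x, t • (u * y)), z) := by
  simp only [mulLeftY, mul_smul_comm]

/-- `mulLeftY u` is continuous. [folklore] -/
theorem continuous_mulLeftY (u : ℍ) : Continuous (mulLeftY u) :=
  ((continuous_fst.comp continuous_fst).prodMk ((continuous_snd.comp continuous_fst).const_mul u)).prodMk continuous_snd

/-- `mulLeftY u` is measurable. [folklore] -/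
theorem measurable_mulLeftY (u : ℍ) : Measurable (mulLeftY u) :=
  ((measurable_fst.comp measurable_fst).prodMk ((measurable_snd.comp measurable_fst).const_mul u)).prodMk measurable_snd

/-- `(u, w) ↦ mulLeftY u w` is jointly measurable. [folklore] -/
theorem measurable_mulLeftY_uncurry : Measurable fun p : ℍ × ((ℍ × ℍ) × ℍ) => mulLeftY p.1 p.2 :=
  ((measurable_fst.comp (measurable_fst.comp measurable_snd)).prodMk
    (measurable_fst.mul (measurable_snd.comp (measurable_fst.comp measurable_snd)))).prodMk (measurable_snd.comp measurable_snd)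

/-- Left multiplication by a unit preserves the norm of the `y`-letter. [folklore] -/
theorem norm_mulLeftY_fst_snd {u : ℍ} (hu : ‖u‖ = 1) (w : (ℍ × ℍ) × ℍ) : ‖(mulLeftY u w).1.2‖ = ‖w.1.2‖ := by
  rw [mulLeftY_fst_snd, norm_mul, hu, one_mul]

/-- For a unit `u`, `mulLeftY u` preserves the product of unit balls `ball3`. [folklore] -/
theorem mulLeftY_mem_ball3 {u : ℍ} (hu : ‖u‖ = 1) (w : (ℍ × ℍ) × ℍ) : mulLeftY u w ∈ ball3 ↔ w ∈ ball3 := by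
  rw [mem_ball3_iff, mem_ball3_iff, norm_mulLeftY_fst_snd hu, mulLeftY_fst_fst, mulLeftY_snd]

/-! ## §2 The translated gnomonic point -/

/-- **THE TRANSLATED GNOMONIC POINT**: hub `a`, hemisphere signs `ε`, gnomonic coordinates `η`, the `y`-letter left-translated by `u`:
`(a, (((±(1,η_x), u·(±(1,η_y))), ±(1,η_z)), f ↦ ±(1,η_f)))`. [folklore] -/
def trGnomonicPoint (u : ℍ) (a : ℍ) (ε : GnoSign L) (η : GnoCoord L) : ℍ × (((ℍ × ℍ) × ℍ) × (Fol L → ℍ)) :=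
  (a, (((gnoLetter ε.1.1 η.1.1, u * gnoLetter ε.1.2 η.1.2), gnoLetter ε.2.1 η.2.1), fun f => gnoLetter (ε.2.2 f) (η.2.2 f)))

omit [NeZero L] in
/-- Unfolding `trGnomonicPoint`. [folklore] -/
theorem trGnomonicPoint_apply (u a : ℍ) (ε : GnoSign L) (η : GnoCoord L) :
    trGnomonicPoint u a ε η = (a, (((gnoLetter ε.1.1 η.1.1, u * gnoLetter ε.1.2 η.1.2), gnoLetter ε.2.1 η.2.1), fun f => gnoLetter (ε.2.2 f) (η.2.2 f))) := rfl

omit [NeZero L] in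
/-- ★ The translated point is the master point with `mulLeftY u` applied to its leader letters (same hub, same followers). [folklore] -/
theorem trGnomonicPoint_eq_mulLeftY (u a : ℍ) (ε : GnoSign L) (η : GnoCoord L) :
    trGnomonicPoint u a ε η = ((gnomonicPoint a ε η).1, (mulLeftY u (gnomonicPoint a ε η).2.1, (gnomonicPoint a ε η).2.2)) := rfl

omit [NeZero L] in
/-- `u = 1` recovers the master gnomonic point. [folklore] -/
@[simp] theorem trGnomonicPoint_one (a : ℍ) (ε : GnoSign L) (η : GnoCoord L) : trGnomonicPoint 1 a ε η = gnomonicPoint a ε η := by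
  simp only [trGnomonicPoint, gnomonicPoint, one_mul]

omit [NeZero L] in
/-- The hub of the translated point. [folklore] -/
theorem trGnomonicPoint_fst (u a : ℍ) (ε : GnoSign L) (η : GnoCoord L) : (trGnomonicPoint u a ε η).1 = a := rfl

omit [NeZero L] in
/-- The followers of the translated point are those of the master point. [folklore] -/
theorem trGnomonicPoint_followers (u a : ℍ) (ε : GnoSign L) (η : GnoCoord L) :
    (trGnomonicPoint u a ε η).2.2 = (gnomonicPoint a ε η).2.2 := rfl

omit [NeZero L] in
/-- `trGnomonicPoint u a ε` is measurable in the coordinates. [folklore] -/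
theorem measurable_trGnomonicPoint (u a : ℍ) (ε : GnoSign L) : Measurable (trGnomonicPoint (L := L) u a ε) := by
  refine measurable_const.prodMk (Measurable.prodMk (Measurable.prodMk (Measurable.prodMk ?_ ?_) ?_) ?_)
  · exact (measurable_gnoLetter _).comp (measurable_fst.comp measurable_fst)
  · exact ((measurable_gnoLetter _).comp (measurable_snd.comp measurable_fst)).const_mul u
  · exact (measurable_gnoLetter _).comp (measurable_fst.comp measurable_snd)
  · exact measurable_pi_lambda _ fun f => (measurable_gnoLetter _).comp ((measurable_pi_apply f).comp (measurable_snd.comp measurable_snd))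

omit [NeZero L] in
/-- `(a, η) ↦ trGnomonicPoint u a ε η` is jointly measurable. [folklore] -/
theorem measurable_trGnomonicPoint_uncurry (u : ℍ) (ε : GnoSign L) : Measurable fun p : ℍ × GnoCoord L => trGnomonicPoint (L := L) u p.1 ε p.2 := by
  show Measurable fun p : ℍ × GnoCoord L => (p.1, (trGnomonicPoint (L := L) u 0 ε p.2).2)
  exact measurable_fst.prodMk ((measurable_snd.comp (measurable_trGnomonicPoint u 0 ε)).comp measurable_snd)

omit [NeZero L] in
/-- ★ **THE CHART POINT OF THE TRANSLATED GNOMONIC POINT** (scale `1`): leaders `leaderTuple a ((±(1,η_x), u·(±(1,η_y))), ±(1,η_z))` — so `C₂ = Q(u·ŷ)` —,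
followers `Q(±(1,η_f))`. [folklore] -/
theorem blowUpPoint_one_trGnomonicPoint (u a : ℍ) (ε : GnoSign L) (η : GnoCoord L) :
    blowUpPoint (L := L) 1 (trGnomonicPoint u a ε η) =
      (leaderTuple a ((gnoLetter ε.1.1 η.1.1, u * gnoLetter ε.1.2 η.1.2), gnoLetter ε.2.1 η.2.1), fun i => quatToSU2 (gnoLetter (ε.2.2 i) (η.2.2 i))) := by
  simp only [blowUpPoint, trGnomonicPoint, dil3_one', dilateIm_one_apply]

omit [NeZero L] in
/-- The translated leader `C₂` is `Q(u)·Q(ŷ)` when `u ≠ 0` (✓`T4HaarSU2Translate.quatToSU2_mul`, ✓`quatToSU2_smul`). [folklore] -/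
theorem blowUpPoint_one_trGnomonicPoint_leader_two {u : ℍ} (hu : u ≠ 0) (a : ℍ) (ε : GnoSign L) (η : GnoCoord L) :
    (blowUpPoint (L := L) 1 (trGnomonicPoint u a ε η)).1 2 = quatToSU2 u * quatToSU2 (gnoLetter ε.1.2 η.1.2) := by
  rw [blowUpPoint_one_trGnomonicPoint]
  show leaderTuple a ((gnoLetter ε.1.1 η.1.1, u * gnoLetter ε.1.2 η.1.2), gnoLetter ε.2.1 η.2.1) 2 = _
  have hy : gnoLetter ε.1.2 η.1.2 ≠ 0 := gnoLetter_ne_zero _ _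
  rw [(BlowUp.leaderTuple_apply a _).2.2.1, Literature.MathematicalPhysics.QuantumFieldTheory.Balaban1983to89.T4HaarSU2Translate.quatToSU2_mul _ hu,
    Literature.MathematicalPhysics.QuantumFieldTheory.Balaban1983to89.T4HaarSU2Translate.su2Quat_quatToSU2 hy, mul_smul_comm,
    quatToSU2_smul (inv_pos.2 (norm_pos_iff.2 hy))]

/-! ## §3 The deficit read in the translated chart -/

/-- **THE σ-GLUED DEFICIT OF SECTOR `z` IN THE TRANSLATED CHART**: `F̂ᵘ_{a,ε}(η) := chartDeficit L z χ (blowUpPoint 1 (trGnomonicPoint u a ε η))`. [cite: Luscher1983, §2] -/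
def trGnoDeficit (u : ℍ) (z : Fin 3 → Bool) (χ : Site 3 L → SU2) (a : ℍ) (ε : GnoSign L) (η : GnoCoord L) : ℝ :=
  chartDeficit L z χ (blowUpPoint 1 (trGnomonicPoint u a ε η))

/-- Unfolding `trGnoDeficit`. [folklore] -/
theorem trGnoDeficit_def (u : ℍ) (z : Fin 3 → Bool) (χ : Site 3 L → SU2) (a : ℍ) (ε : GnoSign L) (η : GnoCoord L) :
    trGnoDeficit u z χ a ε η = chartDeficit L z χ (blowUpPoint 1 (trGnomonicPoint u a ε η)) := rfl

/-- `u = 1` recovers the master deficit ✓`gnoDeficit`. [folklore] -/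
@[simp] theorem trGnoDeficit_one (z : Fin 3 → Bool) (χ : Site 3 L → SU2) (a : ℍ) (ε : GnoSign L) (η : GnoCoord L) :
    trGnoDeficit 1 z χ a ε η = gnoDeficit z χ a ε η := by
  rw [trGnoDeficit, trGnomonicPoint_one]; rfl

/-- `0 ≤ F̂ᵘ`. [cite: Luscher1983, §2] -/
theorem trGnoDeficit_nonneg (u : ℍ) (z : Fin 3 → Bool) (χ : Site 3 L → SU2) (a : ℍ) (ε : GnoSign L) (η : GnoCoord L) : 0 ≤ trGnoDeficit u z χ a ε η :=
  chartDeficit_nonneg z χ _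

/-- `F̂ᵘ_{a,ε}` is measurable in the coordinates. [folklore] -/
theorem measurable_trGnoDeficit (u : ℍ) (z : Fin 3 → Bool) (χ : Site 3 L → SU2) (a : ℍ) (ε : GnoSign L) : Measurable (trGnoDeficit (L := L) u z χ a ε) :=
  (measurable_chartDeficit z χ).comp ((measurable_blowUpPoint 1).comp (measurable_trGnomonicPoint u a ε))

/-- `(a, η) ↦ F̂ᵘ_{a,ε}(η)` is jointly measurable. [folklore] -/
theorem measurable_trGnoDeficit_uncurry (u : ℍ) (z : Fin 3 → Bool) (χ : Site 3 L → SU2) (ε : GnoSign L) :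
    Measurable fun p : ℍ × GnoCoord L => trGnoDeficit u z χ p.1 ε p.2 :=
  (measurable_chartDeficit z χ).comp ((measurable_blowUpPoint 1).comp (measurable_trGnomonicPoint_uncurry u ε))

/-- ★ The translated deficit unfolded to the ring: `F̂ᵘ_{a,ε}(η) = F^S_z (fixHistory (ringConfig χ (leaderTuple a ((x̂, u·ŷ), ẑ), Q(followers))))`. [cite: Luscher1983, §2] -/
theorem trGnoDeficit_eq_swapRingDeficit (u : ℍ) (z : Fin 3 → Bool) (χ : Site 3 L → SU2) (a : ℍ) (ε : GnoSign L) (η : GnoCoord L) :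
    trGnoDeficit u z χ a ε η = SwapRing.swapRingDeficit L z (fixHistory (ringConfig χ
      (leaderTuple a ((gnoLetter ε.1.1 η.1.1, u * gnoLetter ε.1.2 η.1.2), gnoLetter ε.2.1 η.2.1), fun i => quatToSU2 (gnoLetter (ε.2.2 i) (η.2.2 i))))) := by
  rw [trGnoDeficit, blowUpPoint_one_trGnomonicPoint]; rfl

end Summit.QuantumFields.YangMills.Theorems.SwapVirialDeficit.BlowUpRing

end
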